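import Literature.NumberTheory.EllipticCurves.Greenberg1999.TwoTorsionLinesTateRigidity
import Literature.NumberTheory.EllipticCurves.Greenberg1999.TwoTorsionLinesTateCoordinates
import Literature.NumberTheory.EllipticCurves.TateCurve.NumberFieldUniformizationTwisted
import Literature.NumberTheory.EllipticCurves.TateCurve.UniformizationHolds
import Literature.NumberTheory.EllipticCurves.TamagawaPrimesEquivProofs
import Literature.NumberTheory.EllipticCurves.LocalTorsionMultiplicativeProofs
import Literature.NumberTheory.EllipticCurves.PAdicHeightsProofs
import Literature.NumberTheory.GaloisRepresentations.PadicAlgebraDegreeOnePlace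
import HarnessLib

/-!
# Greenberg's line dictionary at `p = 2`, PROOF of the Tate-line half
# (`twoTorsion_mem_tateLine_iff_ramifiedAtTwo_holds`)

Discharges the named fact `Greenberg1999.twoTorsion_mem_tateLine_iff_ramifiedAtTwo` of
`Greenberg1999/TwoTorsionLines.lean` in the kernel (no hypotheses): at a prime `2` of MULTIPLICATIVE
reduction of a globally minimal `E/ℚ`, for EVERY twisted Tate parametrisation `(q, t, Ψ)` of
`E(ℚ̄_v)` (`v ∣ 2`) with the clauses of Silverman, *ATAEC* V.5.2 (c)/V.5.3/V.5.4, a rational point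
`P = (x, y)` of order `2` lies on the Tate line `Ψ(μ)` iff `v₂(x) < 0`. Proof-only file (one
theorem; no definitions, no named facts), following the printed sources:

1. (Silverman *ATAEC* V.5.3, tree `TateCurve.isomorphic_tateCurve_of_one_lt_norm_j_holds`,
   `TateCurve.tatePointAlg*`) a REFERENCE parametrisation `Ψ₁ = e⁻¹ ∘ φ`, with
   `φ(u) = (X(u,q₁), Y(u,q₁))` Tate's map and `e` the change of coordinates `C : E ≅ E_{q₁}` over
   `ℚ̄_v`, twisted-equivariant for the SAME `t` (`TateCurve.smul_eq_sign_smul`, Lemma V.5.2 (c));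
2. (Greenberg LNM 1716 §5: `C₂ ≅ μ_{2^∞}` is canonical) `Ψ(-1) = Ψ₁(-1)` for every admissible `Ψ` —
   `twistedUniformisation_neg_one_eq` (`TwoTorsionLinesTateRigidity.lean`), using `ζ₈ ∉ ℚ₂`
   (`pow_four_ne_neg_one`);
3. (Silverman *ATAEC* §V.4) `‖X(-1, q₁)‖ = ‖2‖⁻² > 1` and `‖X(u, q₁)‖ < 1` for `‖u‖² = ‖q₁‖`
   (`one_lt_norm_tateX_neg_one`, `norm_tateX_lt_one_of_norm_sq_eq` of
   `TwoTorsionLinesTateCoordinates.lean`);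
4. (Silverman *AEC* VII.1.3 (d)) `‖u_C‖ = 1`, `‖r_C‖ ≤ 1` (both models have unit `c₄` at `v`:
   `2 ∤ c₄` of the minimal model at a multiplicative prime, `c₄(E_q) = E₄(q)`), so
   `‖x‖ > 1 ⟺ ‖X‖ > 1` along `X = u⁻²(x - r)`;
5. glue: `‖x‖_v > 1 ⟺ v₂(x) < 0` for `x ∈ ℚ` (`one_lt_valued_iff_padicValRat_neg`).

References: [GreenbergLNM1716] §5 pp. 168–176; [SilvermanATAEC1994] Lemma V.4.1.2, Thm. V.3.1,
Lemma V.5.2, Thm. V.5.3, Cor. V.5.4 (PDF pp. 394–410); [SilvermanAEC2009] VII.1.3 (d), VII.2.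
-/

noncomputable section

open scoped Classical NNReal

open NumberField IsDedekindDomain Field WeierstrassCurve
  Literature.NumberTheory.EllipticCurves Literature.NumberTheory.EllipticCurves.TateCurve
  Literature.NumberTheory.GaloisRepresentations

open Literature.NumberTheory.EllipticCurves.SteinWuthrich2013 (tateCurve tateA4 tateA6)

namespace Literature.NumberTheory.EllipticCurves.Greenberg1999

/-- For `0 < s < 1`: `s ^ j = 1` forces `j = 0`. [folklore] -/
private theorem int_eq_zero_of_zpow_eq_one {s : ℝ} (hs0 : 0 < s) (hs1 : s < 1) {j : ℤ}
    (h : s ^ j = 1) : j = 0 := by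
  have h' := congrArg Real.log h
  rw [Real.log_zpow, Real.log_one] at h'
  exact_mod_cast (mul_eq_zero.mp h').resolve_right (Real.log_neg hs0 hs1).ne

/-! ## §1 The change of coordinates `C : E ≅ E_q` over `ℚ̄_v` is integral with unit `u` -/

section ChangeOfCoordinates

variable (W : WeierstrassCurve ℚ) [W.IsElliptic] [W.IsGloballyMinimal] (v : HeightOneSpectrum (𝓞 ℚ))

/-- **Silverman *AEC* VII.1.3 (d) for the `ℚ̄_v`-isomorphism `C : E ≅ E_q` of *ATAEC* V.5.3 (a)** at a
prime `2` of multiplicative reduction of the globally minimal `E/ℚ`: both `E` (integer coefficients,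
`2 ∤ c₄` — *AEC* VII.5.1 (b)) and the Tate curve `E_q` (`c₄(E_q) = E₄(q)`, a unit) are integral for the
spectral norm of `ℚ̄_v` with unit `c₄`, so `|u_C| = 1` and `|r_C| ≤ 1`.
[cite: SilvermanAEC2009, VII.1 Prop. 1.3 (d) and VII.5 Prop. 5.1 (b)]
[cite: SilvermanATAEC1994, Thm. V.3.1 (b) and Thm. V.5.3 (a)] -/
private theorem spectralNorm_u_eq_one_and_r_le_one (hmult : W.HasMultiplicativeReductionAtPrime 2)
    (hv : ((2 : ℕ) : 𝓞 ℚ) ∈ v.asIdeal) {q₁ : v.adicCompletion ℚ} (hq₁ : ‖q₁‖ < 1)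
    (C : VariableChange (AlgebraicClosure (v.adicCompletion ℚ)))
    (hC : C • (W.baseChange (v.adicCompletion ℚ)).baseChange (AlgebraicClosure (v.adicCompletion ℚ)) =
      (tateCurve q₁).baseChange (AlgebraicClosure (v.adicCompletion ℚ))) :
    spectralNorm (v.adicCompletion ℚ) (AlgebraicClosure (v.adicCompletion ℚ))
        (C.u : AlgebraicClosure (v.adicCompletion ℚ)) = 1 ∧
      spectralNorm (v.adicCompletion ℚ) (AlgebraicClosure (v.adicCompletion ℚ)) C.r ≤ 1 := by
  haveI : Fact (Nat.Prime 2) := ⟨Nat.prime_two⟩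
  -- ## algebra first (no norms): the coefficients of `V = E ⊗ ℚ̄_v` and of `E_q`
  -- the coefficients of `W` are the integers of `integralModelInt W`
  have hW := map_integralModelInt W
  have ha₁ : W.a₁ = ((integralModelInt W).a₁ : ℚ) := by
    conv_lhs => rw [← hW]
    rw [map_a₁, eq_intCast]
  have ha₂ : W.a₂ = ((integralModelInt W).a₂ : ℚ) := by
    conv_lhs => rw [← hW]
    rw [map_a₂, eq_intCast]
  have ha₃ : W.a₃ = ((integralModelInt W).a₃ : ℚ) := by
    conv_lhs => rw [← hW]
    rw [map_a₃, eq_intCast]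
  have ha₄ : W.a₄ = ((integralModelInt W).a₄ : ℚ) := by
    conv_lhs => rw [← hW]
    rw [map_a₄, eq_intCast]
  have ha₆ : W.a₆ = ((integralModelInt W).a₆ : ℚ) := by
    conv_lhs => rw [← hW]
    rw [map_a₆, eq_intCast]
  have hc₄W : W.c₄ = ((integralModelInt W).c₄ : ℚ) := by
    conv_lhs => rw [← hW]
    rw [map_c₄, eq_intCast]
  set V := (W.baseChange (v.adicCompletion ℚ)).baseChange (AlgebraicClosure (v.adicCompletion ℚ))
    with hV_def
  have hVa₁ : V.a₁ = algebraMap (v.adicCompletion ℚ) (AlgebraicClosure (v.adicCompletion ℚ))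
      ((((integralModelInt W).a₁ : ℤ) : ℚ) : v.adicCompletion ℚ) := by
    rw [hV_def]
    simp only [WeierstrassCurve.baseChange, WeierstrassCurve.map_a₁, eq_ratCast, ha₁]
  have hVa₂ : V.a₂ = algebraMap (v.adicCompletion ℚ) (AlgebraicClosure (v.adicCompletion ℚ))
      ((((integralModelInt W).a₂ : ℤ) : ℚ) : v.adicCompletion ℚ) := by
    rw [hV_def]
    simp only [WeierstrassCurve.baseChange, WeierstrassCurve.map_a₂, eq_ratCast, ha₂]
  have hVa₃ : V.a₃ = algebraMap (v.adicCompletion ℚ) (AlgebraicClosure (v.adicCompletion ℚ))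
      ((((integralModelInt W).a₃ : ℤ) : ℚ) : v.adicCompletion ℚ) := by
    rw [hV_def]
    simp only [WeierstrassCurve.baseChange, WeierstrassCurve.map_a₃, eq_ratCast, ha₃]
  have hVa₄ : V.a₄ = algebraMap (v.adicCompletion ℚ) (AlgebraicClosure (v.adicCompletion ℚ))
      ((((integralModelInt W).a₄ : ℤ) : ℚ) : v.adicCompletion ℚ) := by
    rw [hV_def]
    simp only [WeierstrassCurve.baseChange, WeierstrassCurve.map_a₄, eq_ratCast, ha₄]
  have hVa₆ : V.a₆ = algebraMap (v.adicCompletion ℚ) (AlgebraicClosure (v.adicCompletion ℚ))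
      ((((integralModelInt W).a₆ : ℤ) : ℚ) : v.adicCompletion ℚ) := by
    rw [hV_def]
    simp only [WeierstrassCurve.baseChange, WeierstrassCurve.map_a₆, eq_ratCast, ha₆]
  have hVc₄ : V.c₄ = algebraMap (v.adicCompletion ℚ) (AlgebraicClosure (v.adicCompletion ℚ))
      ((((integralModelInt W).c₄ : ℤ) : ℚ) : v.adicCompletion ℚ) := by
    rw [hV_def]
    simp only [WeierstrassCurve.baseChange, WeierstrassCurve.map_c₄, eq_ratCast, hc₄W]
  have hV'a₁ : (C • V).a₁ = algebraMap (v.adicCompletion ℚ) (AlgebraicClosure (v.adicCompletion ℚ))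
      1 := by rw [hC]; simp only [WeierstrassCurve.baseChange, WeierstrassCurve.map_a₁, tateCurve_a₁]
  have hV'a₂ : (C • V).a₂ = 0 := by
    rw [hC]; simp only [WeierstrassCurve.baseChange, WeierstrassCurve.map_a₂, tateCurve_a₂, map_zero]
  have hV'a₃ : (C • V).a₃ = 0 := by
    rw [hC]; simp only [WeierstrassCurve.baseChange, WeierstrassCurve.map_a₃, tateCurve_a₃, map_zero]
  have hV'a₄ : (C • V).a₄ = algebraMap (v.adicCompletion ℚ) (AlgebraicClosure (v.adicCompletion ℚ))
      (tateA4 q₁) := by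
    rw [hC]; simp only [WeierstrassCurve.baseChange, WeierstrassCurve.map_a₄, tateCurve_a₄]
  have hV'a₆ : (C • V).a₆ = algebraMap (v.adicCompletion ℚ) (AlgebraicClosure (v.adicCompletion ℚ))
      (tateA6 q₁) := by
    rw [hC]; simp only [WeierstrassCurve.baseChange, WeierstrassCurve.map_a₆, tateCurve_a₆]
  have hV'c₄ : (C • V).c₄ = algebraMap (v.adicCompletion ℚ) (AlgebraicClosure (v.adicCompletion ℚ))
      (tateCurve q₁).c₄ := by
    rw [hC]; simp only [WeierstrassCurve.baseChange, WeierstrassCurve.map_c₄]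
  -- ## norms: `ℚ_v` with its valuation norm, `ℚ̄_v` with the spectral norm
  letI := GaloisRepresentations.Ultrametric.AdicCompletion.nontriviallyNormedField ℚ v
  haveI := TateCurve.charZero_adicCompletion' ℚ v
  letI : NontriviallyNormedField (AlgebraicClosure (v.adicCompletion ℚ)) :=
    spectralNorm.nontriviallyNormedField (v.adicCompletion ℚ) (AlgebraicClosure (v.adicCompletion ℚ))
  letI : NormedAlgebra (v.adicCompletion ℚ) (AlgebraicClosure (v.adicCompletion ℚ)) :=
    spectralNorm.normedAlgebra (v.adicCompletion ℚ) (AlgebraicClosure (v.adicCompletion ℚ))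
  haveI : IsUltrametricDist (AlgebraicClosure (v.adicCompletion ℚ)) :=
    IsUltrametricDist.isUltrametricDist_of_isNonarchimedean_norm
      (isNonarchimedean_spectralNorm (K := v.adicCompletion ℚ)
        (L := AlgebraicClosure (v.adicCompletion ℚ)))
  change ‖(C.u : AlgebraicClosure (v.adicCompletion ℚ))‖ = 1 ∧ ‖C.r‖ ≤ 1
  have hwle : ∀ z : AlgebraicClosure (v.adicCompletion ℚ),
      NormedField.valuation z ≤ 1 ↔ ‖z‖ ≤ 1 := fun z ↦ by
    rw [NormedField.valuation_apply, ← NNReal.coe_le_coe, coe_nnnorm, NNReal.coe_one]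
  have hweq : ∀ z : AlgebraicClosure (v.adicCompletion ℚ),
      NormedField.valuation z = 1 ↔ ‖z‖ = 1 := fun z ↦ by
    rw [NormedField.valuation_apply, ← NNReal.coe_inj, coe_nnnorm, NNReal.coe_one]
  -- integers have norm `≤ 1` in `ℚ̄_v`, odd integers norm `1`
  have hgen : (Rat.HeightOneSpectrum.natGenerator v : ℤ) = 2 := by
    rw [(Nat.prime_dvd_prime_iff_eq (Rat.HeightOneSpectrum.prime_natGenerator v)
      Nat.prime_two).mp ((Rat.natCast_mem_asIdeal_iff v).mp hv)]
    rfl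
  have hint : ∀ n : ℤ, ‖algebraMap (v.adicCompletion ℚ) (AlgebraicClosure (v.adicCompletion ℚ))
      (((n : ℤ) : ℚ) : v.adicCompletion ℚ)‖ ≤ 1 := fun n ↦ by
    rw [norm_algebraMap', Valued.toNormedField.norm_le_one_iff, Rat.valued_ratCast,
      Rat.valuation_intCast]
    exact HeightOneSpectrum.intValuation_le_one _ _
  have hodd : ∀ n : ℤ, ¬ (2 : ℤ) ∣ n → ‖algebraMap (v.adicCompletion ℚ)
      (AlgebraicClosure (v.adicCompletion ℚ)) (((n : ℤ) : ℚ) : v.adicCompletion ℚ)‖ = 1 := by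
    intro n hn
    have hval : Valued.v (((n : ℤ) : ℚ) : v.adicCompletion ℚ) = 1 := by
      rw [Rat.valued_ratCast]
      exact Rat.valuation_intCast_eq_one v (by rwa [hgen])
    rw [norm_algebraMap']
    exact le_antisymm (Valued.toNormedField.norm_le_one_iff.mpr hval.le)
      (Valued.toNormedField.one_le_norm_iff.mpr hval.ge)
  haveI hVint : V.IsIntegral
      (NormedField.valuation (K := AlgebraicClosure (v.adicCompletion ℚ))).integer :=
    isIntegral_of_val_le_one V
      ((hwle _).mpr (by rw [hVa₁]; exact hint _)) ((hwle _).mpr (by rw [hVa₂]; exact hint _))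
      ((hwle _).mpr (by rw [hVa₃]; exact hint _)) ((hwle _).mpr (by rw [hVa₄]; exact hint _))
      ((hwle _).mpr (by rw [hVa₆]; exact hint _))
  -- the Tate curve is integral (`|a₄|, |a₆| ≤ |q| < 1`)
  have h12 : (12 : v.adicCompletion ℚ) ≠ 0 := by norm_num
  haveI hV'int : (C • V).IsIntegral
      (NormedField.valuation (K := AlgebraicClosure (v.adicCompletion ℚ))).integer :=
    isIntegral_of_val_le_one _
      ((hwle _).mpr (by rw [hV'a₁, map_one, norm_one]))
      ((hwle _).mpr (by rw [hV'a₂, norm_zero]; exact zero_le_one))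
      ((hwle _).mpr (by rw [hV'a₃, norm_zero]; exact zero_le_one))
      ((hwle _).mpr (by rw [hV'a₄, norm_algebraMap']; exact (norm_tateA4_le hq₁.le).trans hq₁.le))
      ((hwle _).mpr (by rw [hV'a₆, norm_algebraMap']; exact (norm_tateA6_le hq₁ h12).trans hq₁.le))
  have hc : NormedField.valuation V.c₄ = 1 := by
    rw [hweq, hVc₄]
    exact hodd _ (LocalTorsionMult.dvd_Δ_and_not_dvd_c₄_integralModelInt_of_mult W 2 hmult).2
  have hc' : NormedField.valuation (C • V).c₄ = 1 := by
    rw [hweq, hV'c₄, tateCurve_c₄, norm_algebraMap']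
    exact norm_tateE4_eq_one hq₁
  obtain ⟨hu, hr⟩ := val_u_eq_one_and_val_r_le_one_of_val_c₄ V C hc hc'
  exact ⟨(hweq _).mp hu, (hwle _).mp hr⟩

end ChangeOfCoordinates

/-! ## §2 The theorem -/

section Main

/-- **Greenberg's dictionary at `p = 2`, Tate-line half, PROVED**: the named fact
`twoTorsion_mem_tateLine_iff_ramifiedAtTwo` holds — for `E/ℚ` globally minimal with multiplicative
reduction at `2`, ANY twisted Tate parametrisation `(q, t, Ψ)` of `E(ℚ̄_v)` (`v ∣ 2`) with the clauses
of Silverman *ATAEC* V.5.2 (c)/V.5.3/V.5.4, and a rational point `P = (x, y)` of order `2`: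
`ι(P) ∈ Ψ(μ) ⟺ v₂(x) < 0`. Proof (module docstring): reference parametrisation through Tate's map
and the `ℚ̄_v`-isomorphism `E ≅ E_q` (V.5.3), rigidity of `Ψ(-1)` (Greenberg's `C₂ ≅ μ_{2^∞}`,
`ζ₈ ∉ ℚ₂`), `‖X(-1,q)‖ = ‖2‖⁻² > 1` and `‖X(u, q)‖ < 1` on `|u|² = |q|` (§V.4), integrality of the
change of coordinates (AEC VII.1.3 (d)), and `‖x‖_v > 1 ⟺ v₂(x) < 0`.
[cite: GreenbergLNM1716, §5 p. 168 and p. 176] [cite: SilvermanATAEC1994, Lemma V.4.1.2, Thm. V.5.3, Cor. V.5.4]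
[cite: SilvermanAEC2009, VII.1.3 (d) and VII.2] -/
theorem twoTorsion_mem_tateLine_iff_ramifiedAtTwo_holds :
    twoTorsion_mem_tateLine_iff_ramifiedAtTwo := by
  intro W _ _ hmult v hv q t Ψ hq0 hq ht hsurj hker hequiv x y hxy h2y
  haveI : Fact (Nat.Prime 2) := ⟨Nat.prime_two⟩
  -- `ℚ_v` with its valuation norm (nontrivially normed wrapper). NB: `CharZero ℚ_v` is registered
  -- only AFTER all statements mentioning `E(ℚ̄_v)` / `E ⊗ ℚ_v` have been elaborated — with it in
  -- scope `Algebra ℚ _` resolves through `DivisionRing.toRatAlgebra` and no longer matches the fact.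
  letI := GaloisRepresentations.Ultrametric.AdicCompletion.nontriviallyNormedField ℚ v
  -- ### the image `P₀ ∈ E(ℚ̄_v)` of the rational point `P = (x, y)` and its coordinates
  set P₀ : localPoints W (v.adicCompletion ℚ) :=
    pointsMap W (v.adicCompletion ℚ) (toGeomPoints W (.some x y hxy)) with hP₀_def
  obtain ⟨X₀, Y₀, h₀, hP₀, hX₀, hY₀⟩ : ∃ X₀ Y₀ h₀, P₀ = (Affine.Point.some X₀ Y₀ h₀ :
      (W.baseChange (AlgebraicClosure (v.adicCompletion ℚ))).toAffine.Point) ∧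
      X₀ = ((x : ℚ) : AlgebraicClosure (v.adicCompletion ℚ)) ∧
      Y₀ = ((y : ℚ) : AlgebraicClosure (v.adicCompletion ℚ)) := by
    refine ⟨_, _, _, rfl, ?_, ?_⟩ <;> simp only [eq_ratCast, map_ratCast]
  -- `P₀` has order `2` (`-P₀ = P₀` from `2y + a₁x + a₃ = 0`) and `P₀ ≠ 0`
  have hnegY : Y₀ = (W.baseChange (AlgebraicClosure (v.adicCompletion ℚ))).toAffine.negY X₀ Y₀ := by
    -- push `2y + a₁x + a₃ = 0` to `ℚ̄_v` along a ring homomorphism (no `CharZero ℚ̄_v` in scope yet)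
    have h := congrArg ((algebraMap (v.adicCompletion ℚ) (AlgebraicClosure (v.adicCompletion ℚ))).comp
      (algebraMap ℚ (v.adicCompletion ℚ))) h2y
    simp only [map_add, map_mul, map_ofNat, map_zero, eq_ratCast] at h
    simp only [Affine.negY, WeierstrassCurve.baseChange, WeierstrassCurve.map_a₁,
      WeierstrassCurve.map_a₃, eq_ratCast, hX₀, hY₀]
    linear_combination h
  have hP₀2 : P₀ + P₀ = 0 := by
    rw [hP₀]
    exact Affine.Point.add_of_Y_eq rfl hnegY
  have hP₀0 : P₀ ≠ 0 := by
    rw [hP₀]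
    exact Affine.Point.some_ne_zero _
  -- ### the reference parametrisation `Ψ₁ = e⁻¹ ∘ φ` (Silverman V.5.3, V.3.1)
  have hv2' : ((Rat.HeightOneSpectrum.primesEquiv v : Nat.Primes) : ℕ) = 2 :=
    LocalField.primesEquiv_eq_of_natCast_mem 2 v hv
  have hmultv : W.HasMultiplicativeReductionAt v :=
    (hasMultiplicativeReductionAtPrime_primesEquiv_iff_holds W v 2 hv2').mp hmult
  have hj := one_lt_norm_j_baseChange_of_hasMultiplicativeReductionAt W v hmultv
  obtain ⟨hc₄, hc₆⟩ := c₄_ne_zero_and_c₆_ne_zero_of_hasMultiplicativeReductionAt W v hmultv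
  obtain ⟨q₁, hq₁0, hq₁, hq₁j, C, hC⟩ : ∃ q₁ : v.adicCompletion ℚ, q₁ ≠ 0 ∧ ‖q₁‖ < 1 ∧
      tateJ q₁ = (W.baseChange (v.adicCompletion ℚ)).j ∧
      ∃ C : VariableChange (AlgebraicClosure (v.adicCompletion ℚ)),
        C • (W.baseChange (v.adicCompletion ℚ)).baseChange (AlgebraicClosure (v.adicCompletion ℚ)) =
          (tateCurve q₁).baseChange (AlgebraicClosure (v.adicCompletion ℚ)) := by
    haveI := TateCurve.charZero_adicCompletion' ℚ v
    exact isomorphic_tateCurve_of_one_lt_norm_j_holds _ hj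
  obtain ⟨hEc₄, hEc₆⟩ := tateCurve_c₄_ne_zero_and_c₆_ne_zero W v hq₁0 hq₁ hq₁j hj
  have hq₁v : Valued.v q₁ < 1 := Valued.toNormedField.norm_lt_one_iff.mp hq₁
  have hq₁F0 : algebraMap (v.adicCompletion ℚ) (AlgebraicClosure (v.adicCompletion ℚ)) q₁ ≠ 0 :=
    (map_ne_zero _).mpr hq₁0
  -- the isomorphism of point groups `e = C`
  obtain ⟨e, he⟩ : ∃ e : localPoints W (v.adicCompletion ℚ) ≃+ geomPoints (tateCurve q₁),
      ∀ P, e P = Affine.Point.congrEquiv hC (VariableChange.pointEquiv _ C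
        (Affine.Point.congrEquiv (W.baseChange_baseChange_adicCompletion v).symm P)) :=
    ⟨(Affine.Point.congrEquiv (W.baseChange_baseChange_adicCompletion v).symm).trans
      ((VariableChange.pointEquiv _ C).trans (Affine.Point.congrEquiv hC)),
      fun _ ↦ rfl⟩
  have hsign := smul_eq_sign_smul W v hc₄ hc₆ hq₁ hEc₄ hEc₆ C hC ht e he
  obtain ⟨h₀', heP₀⟩ : ∃ h', e P₀ = .some (C.toX X₀) (C.toY X₀ Y₀) h' := by
    rw [he, hP₀, Affine.Point.congrEquiv_some, VariableChange.pointEquiv_some,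
      Affine.Point.congrEquiv_some]
    exact ⟨_, rfl⟩
  -- ### norms: `ℚ̄_v` with the spectral norm (introduced only now: the point groups above are
  -- elaborated with the bare field structure of `ℚ̄_v`), and `CharZero ℚ_v`
  haveI := TateCurve.charZero_adicCompletion' ℚ v
  letI : NontriviallyNormedField (AlgebraicClosure (v.adicCompletion ℚ)) :=
    spectralNorm.nontriviallyNormedField (v.adicCompletion ℚ) (AlgebraicClosure (v.adicCompletion ℚ))
  letI : NormedAlgebra (v.adicCompletion ℚ) (AlgebraicClosure (v.adicCompletion ℚ)) :=
    spectralNorm.normedAlgebra (v.adicCompletion ℚ) (AlgebraicClosure (v.adicCompletion ℚ))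
  haveI : IsUltrametricDist (AlgebraicClosure (v.adicCompletion ℚ)) :=
    IsUltrametricDist.isUltrametricDist_of_isNonarchimedean_norm
      (isNonarchimedean_spectralNorm (K := v.adicCompletion ℚ)
        (L := AlgebraicClosure (v.adicCompletion ℚ)))
  haveI : CharZero (AlgebraicClosure (v.adicCompletion ℚ)) :=
    charZero_of_injective_algebraMap
      (algebraMap (v.adicCompletion ℚ) (AlgebraicClosure (v.adicCompletion ℚ))).injective
  -- `‖2‖ < 1` in `ℚ_v`
  have h2n : ‖(2 : v.adicCompletion ℚ)‖ < 1 := by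
    have h : Valued.v ((2 : ℕ) : v.adicCompletion ℚ) < 1 := by
      rw [valued_two v hv, ← WithZero.exp_zero]
      exact WithZero.exp_lt_exp.mpr (by norm_num)
    have h' := Valued.toNormedField.norm_lt_one_iff.mpr h
    rwa [Nat.cast_ofNat] at h'
  have h20 : (2 : v.adicCompletion ℚ) ≠ 0 := two_ne_zero
  -- `q` in `ℚ̄_v`
  have hqn : ‖q‖ < 1 := Valued.toNormedField.norm_lt_one_iff.mpr hq
  have hqF : ‖algebraMap (v.adicCompletion ℚ) (AlgebraicClosure (v.adicCompletion ℚ)) q‖ < 1 := by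
    rwa [norm_algebraMap']
  have hqFpos : 0 < ‖algebraMap (v.adicCompletion ℚ) (AlgebraicClosure (v.adicCompletion ℚ)) q‖ :=
    norm_pos_iff.mpr ((map_ne_zero _).mpr hq0)
  -- `1 < ‖X₀‖ ⟺ v₂(x) < 0`
  have hX₀iff : 1 < ‖X₀‖ ↔ TwoTorsionRamifiedAtTwo x := by
    have hL := one_lt_valued_iff_padicValRat_neg v hv x
    rw [eq_ratCast] at hL
    rw [hX₀, ← map_ratCast (algebraMap (v.adicCompletion ℚ) (AlgebraicClosure (v.adicCompletion ℚ))) x,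
      norm_algebraMap', Valued.toNormedField.one_lt_norm_iff]
    exact hL
  -- `C` is integral with unit `u`
  obtain ⟨hCu, hCr⟩ : ‖(C.u : AlgebraicClosure (v.adicCompletion ℚ))‖ = 1 ∧ ‖C.r‖ ≤ 1 :=
    spectralNorm_u_eq_one_and_r_le_one W v hmult hv hq₁ C hC
  -- Tate's map `φ` over `ℚ̄_v`
  let φ : Additive (AlgebraicClosure (v.adicCompletion ℚ))ˣ →+ geomPoints (tateCurve q₁) :=
    { toFun := fun a => tatePointAlg q₁ (Additive.toMul a)
      map_zero' := tatePointAlg_of_eq_zpow (F := AlgebraicClosure (v.adicCompletion ℚ))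
        (q := q₁) 1 (n := 0) (by simp)
      map_add' := fun a b => by
        simp only [toMul_add]
        exact tatePointAlg_mul addRelX_eq_zero addRelY_eq_zero hq₁0 hq₁ _ _ }
  have hφ : ∀ u : (AlgebraicClosure (v.adicCompletion ℚ))ˣ,
      φ (Additive.ofMul u) = tatePointAlg q₁ u := fun _ => rfl
  have hequivφ : ∀ (σ : absoluteGaloisGroup (v.adicCompletion ℚ))
      (u : (AlgebraicClosure (v.adicCompletion ℚ))ˣ),
      σ • φ (Additive.ofMul u) = φ (Additive.ofMul (Units.map
        (absoluteGaloisGroup.toAlgEquiv (v.adicCompletion ℚ) σ :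
          AlgebraicClosure (v.adicCompletion ℚ) →* AlgebraicClosure (v.adicCompletion ℚ)) u)) := by
    intro σ u
    rw [hφ, hφ]
    exact map_algEquiv_tatePointAlg hq₁0 hq₁ (absoluteGaloisGroup.toAlgEquiv _ σ) u
  -- `Ψ₁ = e⁻¹ ∘ φ`
  set Ψ₁ := e.symm.toAddMonoidHom.comp φ with hΨ₁_def
  have hΨ₁ : ∀ u : (AlgebraicClosure (v.adicCompletion ℚ))ˣ,
      Ψ₁ (Additive.ofMul u) = e.symm (tatePointAlg q₁ u) := fun _ => rfl
  have hsurj₁ : Function.Surjective Ψ₁ := by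
    intro P
    obtain ⟨u, hu⟩ := tatePointAlg_surjective (F := AlgebraicClosure (v.adicCompletion ℚ))
      addRelX_eq_zero addRelY_eq_zero hq₁0 hq₁ (e P)
    exact ⟨Additive.ofMul u, by rw [hΨ₁, hu, AddEquiv.symm_apply_apply]⟩
  have hker₁ : ∀ u : (AlgebraicClosure (v.adicCompletion ℚ))ˣ, Ψ₁ (Additive.ofMul u) = 0 ↔
      ∃ k : ℤ, (u : AlgebraicClosure (v.adicCompletion ℚ)) =
        algebraMap (v.adicCompletion ℚ) (AlgebraicClosure (v.adicCompletion ℚ)) q₁ ^ k := by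
    intro u
    rw [hΨ₁, AddEquiv.map_eq_zero_iff]
    exact tatePointAlg_eq_zero_iff hq₁0 hq₁ u
  have hequiv₁ : ∀ (σ : absoluteGaloisGroup (v.adicCompletion ℚ))
      (u : (AlgebraicClosure (v.adicCompletion ℚ))ˣ),
      σ • Ψ₁ (Additive.ofMul u) =
        (if absoluteGaloisGroup.toAlgEquiv (v.adicCompletion ℚ) σ t = t then (1 : ℤ) else -1) •
          Ψ₁ (Additive.ofMul (Units.map
            (absoluteGaloisGroup.toAlgEquiv (v.adicCompletion ℚ) σ :
              AlgebraicClosure (v.adicCompletion ℚ) →* AlgebraicClosure (v.adicCompletion ℚ)) u)) := by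
    intro σ u
    change σ • e.symm (φ (Additive.ofMul u)) = _ • e.symm (φ _)
    rw [← hequivφ σ u]
    have h1 := hsign σ (e.symm (φ (Additive.ofMul u)))
    rw [AddEquiv.apply_symm_apply] at h1
    apply e.injective
    rw [map_zsmul, AddEquiv.apply_symm_apply, h1, smul_smul]
    split_ifs <;> simp
  -- ### rigidity: `Ψ(-1) = Ψ₁(-1)` (Greenberg §5; `ζ₈ ∉ ℚ₂`)
  have hrig : Ψ (Additive.ofMul (-1)) = Ψ₁ (Additive.ofMul (-1)) :=
    twistedUniformisation_neg_one_eq v 2 (pow_four_ne_neg_one v hv)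
      (fun σ ↦ if absoluteGaloisGroup.toAlgEquiv (v.adicCompletion ℚ) σ t = t then (1 : ℤ) else -1)
      (fun σ ↦ by split_ifs <;> simp) hq0 hq hq₁0 hq₁v Ψ Ψ₁ hker hequiv hsurj₁ hker₁ hequiv₁
  -- ### coordinates along `e`: `‖C.toX X₀‖ = ‖X₀ - r‖`, compared with `‖X₀‖`
  have htoX : ‖C.toX X₀‖ = ‖X₀ - C.r‖ := by
    rw [VariableChange.toX_def, norm_mul, norm_pow, Units.val_inv_eq_inv_val, norm_inv, hCu,
      inv_one, one_pow, one_mul]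
  have hcmp : 1 < ‖X₀ - C.r‖ ↔ 1 < ‖X₀‖ := by
    constructor
    · intro h
      by_contra hle
      rw [not_lt] at hle
      have h' := IsUltrametricDist.norm_add_le_max X₀ (-C.r)
      rw [← sub_eq_add_neg, norm_neg] at h'
      exact absurd (lt_of_lt_of_le h (h'.trans (max_le hle hCr))) (lt_irrefl _)
    · intro h
      have hne : ‖X₀‖ ≠ ‖-C.r‖ := by
        rw [norm_neg]; exact ne_of_gt (lt_of_le_of_lt hCr h)
      rw [sub_eq_add_neg, IsUltrametricDist.norm_add_eq_max_of_norm_ne_norm hne, norm_neg]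
      exact lt_max_of_lt_left h
  -- key: if `e P₀ = φ(u)` then `X(u, q₁) = C.toX X₀`
  have hkey : ∀ u : (AlgebraicClosure (v.adicCompletion ℚ))ˣ, e P₀ = tatePointAlg q₁ u →
      tateX (algebraMap (v.adicCompletion ℚ) (AlgebraicClosure (v.adicCompletion ℚ)) q₁)
        (u : AlgebraicClosure (v.adicCompletion ℚ)) = C.toX X₀ := by
    intro u hu
    by_cases hmem : ∀ n : ℤ, (u : AlgebraicClosure (v.adicCompletion ℚ)) ≠
        algebraMap (v.adicCompletion ℚ) (AlgebraicClosure (v.adicCompletion ℚ)) q₁ ^ n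
    · rw [tatePointAlg_of_ne_zpow hq₁0 hq₁ u hmem, heP₀] at hu
      exact (Affine.Point.some.inj hu).1.symm
    · exfalso
      push Not at hmem
      obtain ⟨n, hn⟩ := hmem
      rw [tatePointAlg_of_eq_zpow u hn] at hu
      exact hP₀0 (e.injective (hu.trans (map_zero e).symm))
  -- ### the two directions
  constructor
  · -- `(⇒)`: `Ψ(ζ) = P₀` with `ζ` of finite order forces `ζ = -1`, so `P₀ = Ψ₁(-1) = e⁻¹ φ(-1)`
    rintro ⟨ζ, hζfin, hζP⟩
    have h2ζ : Ψ (Additive.ofMul (ζ * ζ)) = 0 := by rw [ofMul_mul, map_add, hζP, hP₀2]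
    obtain ⟨j, hj⟩ := (hker _).mp h2ζ
    have hζnorm : ‖(ζ : AlgebraicClosure (v.adicCompletion ℚ))‖ = 1 := by
      obtain ⟨N, hN, hζN⟩ := hζfin.exists_pow_eq_one
      have h := congrArg (fun z : (AlgebraicClosure (v.adicCompletion ℚ))ˣ ↦
        ‖(z : AlgebraicClosure (v.adicCompletion ℚ))‖) hζN
      simp only [Units.val_pow_eq_pow_val, norm_pow, Units.val_one, norm_one] at h
      exact (pow_eq_one_iff_of_nonneg (norm_nonneg _) hN.ne').mp h
    have hj0 : j = 0 := by
      have h := congrArg norm hj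
      rw [Units.val_mul, norm_mul, hζnorm, mul_one, norm_zpow] at h
      exact int_eq_zero_of_zpow_eq_one hqFpos hqF h.symm
    rw [hj0, zpow_zero, Units.val_mul] at hj
    have hζ1 : ζ = -1 := by
      rcases mul_self_eq_one_iff.mp hj with h | h
      · exfalso
        have h1 : ζ = 1 := Units.ext h
        rw [h1, ofMul_one, map_zero] at hζP
        exact hP₀0 hζP.symm
      · exact Units.ext (by rw [h, Units.val_neg, Units.val_one])
    rw [hζ1, hrig, hΨ₁] at hζP
    have heP : e P₀ = tatePointAlg q₁ (-1) := by rw [← hζP, AddEquiv.apply_symm_apply]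
    have hX := hkey (-1) heP
    rw [Units.val_neg, Units.val_one, ← map_one (algebraMap (v.adicCompletion ℚ)
      (AlgebraicClosure (v.adicCompletion ℚ))), ← map_neg,
      ← map_tateX (algebraMap (v.adicCompletion ℚ) (AlgebraicClosure (v.adicCompletion ℚ)))
        (continuous_algebraMap _ _) hq₁ (-1)] at hX
    have hn : 1 < ‖C.toX X₀‖ := by
      rw [← hX, norm_algebraMap']
      exact one_lt_norm_tateX_neg_one hq₁ h2n h20
    rw [htoX, hcmp] at hn
    exact hX₀iff.mp hn
  · -- `(⇐)`: `v₂(x) < 0`; write `P₀ = Ψ₁(u)` with `u² = q₁^m`: `m` odd is impossible (`‖X‖ < 1`),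
    -- `m` even gives `P₀ = Ψ₁(-1) = Ψ(-1)`
    intro hx
    have hbig : 1 < ‖C.toX X₀‖ := by rw [htoX, hcmp]; exact hX₀iff.mpr hx
    obtain ⟨a, ha⟩ := hsurj₁ P₀
    obtain ⟨u, rfl⟩ : ∃ u : (AlgebraicClosure (v.adicCompletion ℚ))ˣ, Additive.ofMul u = a :=
      ⟨Additive.toMul a, ofMul_toMul a⟩
    have hu2 : Ψ₁ (Additive.ofMul (u * u)) = 0 := by rw [ofMul_mul, map_add, ha, hP₀2]
    obtain ⟨m, hm⟩ := (hker₁ _).mp hu2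
    rw [Units.val_mul] at hm
    set Q₁ : (AlgebraicClosure (v.adicCompletion ℚ))ˣ := Units.mk0 _ hq₁F0 with hQ₁_def
    have hΨ₁Q : Ψ₁ (Additive.ofMul Q₁) = 0 :=
      (hker₁ Q₁).mpr ⟨1, by rw [hQ₁_def, Units.val_mk0, zpow_one]⟩
    have hΨ₁Qk : ∀ k : ℤ, Ψ₁ (Additive.ofMul (u * Q₁ ^ k)) = P₀ := fun k ↦ by
      rw [ofMul_mul, map_add, ofMul_zpow, map_zsmul, hΨ₁Q, smul_zero, add_zero, ha]
    rcases Int.even_or_odd' m with ⟨m', hm' | hm'⟩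
    · -- `m = 2 m'`: `w = u q₁^(-m')` has `w² = 1`
      set w : (AlgebraicClosure (v.adicCompletion ℚ))ˣ := u * Q₁ ^ (-m') with hw_def
      have hw2 : (w : AlgebraicClosure (v.adicCompletion ℚ)) * w = 1 := by
        rw [hw_def, Units.val_mul, Units.val_zpow_eq_zpow_val, hQ₁_def, Units.val_mk0,
          mul_mul_mul_comm, hm, hm', ← zpow_add₀ hq₁F0, ← zpow_add₀ hq₁F0,
          show (2 * m' + (-m' + -m') : ℤ) = 0 by ring, zpow_zero]
      have hΨ₁w : Ψ₁ (Additive.ofMul w) = P₀ := hΨ₁Qk (-m')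
      rcases mul_self_eq_one_iff.mp hw2 with h | h
      · exfalso
        have hw1 : w = 1 := Units.ext h
        rw [hw1, ofMul_one, map_zero] at hΨ₁w
        exact hP₀0 hΨ₁w.symm
      · have hw1 : w = -1 := Units.ext (by rw [h, Units.val_neg, Units.val_one])
        rw [hw1, ← hrig] at hΨ₁w
        exact ⟨-1, isOfFinOrder_iff_pow_eq_one.mpr ⟨2, two_pos, by rw [neg_one_sq]⟩, hΨ₁w⟩
    · -- `m = 2 m' + 1`: `u₀ = u q₁^(-m')` has `u₀² = q₁`, so `‖X(u₀)‖ < 1` — contradiction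
      exfalso
      set u₀ : (AlgebraicClosure (v.adicCompletion ℚ))ˣ := u * Q₁ ^ (-m') with hu₀_def
      have hu₀2 : (u₀ : AlgebraicClosure (v.adicCompletion ℚ)) ^ 2 =
          algebraMap (v.adicCompletion ℚ) (AlgebraicClosure (v.adicCompletion ℚ)) q₁ := by
        rw [sq, hu₀_def, Units.val_mul, Units.val_zpow_eq_zpow_val, hQ₁_def, Units.val_mk0,
          mul_mul_mul_comm, hm, hm', ← zpow_add₀ hq₁F0, ← zpow_add₀ hq₁F0,
          show (2 * m' + 1 + (-m' + -m') : ℤ) = 1 by ring, zpow_one]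
      have hu₀n : ‖(u₀ : AlgebraicClosure (v.adicCompletion ℚ))‖ ^ 2 = ‖q₁‖ := by
        rw [← norm_pow, hu₀2, norm_algebraMap']
      have heP : e P₀ = tatePointAlg q₁ u₀ := by
        rw [← hΨ₁Qk (-m'), hΨ₁, AddEquiv.apply_symm_apply]
      have hX := hkey u₀ heP
      have hlt := norm_tateX_lt_one_of_norm_sq_eq (K := v.adicCompletion ℚ) hq₁0 hq₁ hu₀n
      rw [hX] at hlt
      exact absurd (hbig.trans hlt) (lt_irrefl _)

end Main

end Literature.NumberTheory.EllipticCurves.Greenberg1999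

end
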